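import Summits.ABC.IUTFork.Joshi.ATS4MainBoundsPrimesRamification
import Summits.ABC.IUTFork.Joshi.ATS4RamificationTateDivisor
import Literature.NumberTheory.NumberFields.RelativeDifferentExponentsTower
import Literature.IUT.LogVolume.DistinguishedPrimesBound
import Literature.IUT.LogVolume.DifferentConductorTowerThreeField
import HarnessLib

/-!
# Joshi [ATS IV] (arXiv:2403.10430v2) Lem 6.5.1 on GENUINE number fields: the merge of T-30's abstract ramification
# signature with T-26's tower `L_tpd ⊆ L ⊆ L′`

abc-iut cell, branch E (rung LADDER-ABC:A2.E), seat abc-iut-E-t30; merge-debt row T-26 ↔ T-30 of plan/E/ASSIGNMENTS.md §3.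
**No side is taken** on [IUTchIII] Cor. 3.12, on Joshi's claims, or on Mochizuki's reports on them; unrefereed preprint; typed ≠
proved ≠ endorsed. `Joshi/ATS4MainBoundsPrimesRamification.lean` types Lem 6.5.1 ([J-IV] p.60 l.46–54: «Assume v ∈ V^non_{L_tpd}
such that v does not divide 2·3·5·ℓ and v ∉ Supp(q_{L_tpd}). Then L′/L_tpd is unramified over v. Proof. This is the assertion
[Mochizuki, 2021d, (D0) on Page 654] …») over an ABSTRACT `RamificationDatum` and proves it there from the readings of Lemma
4.1.4 (1),(2); `Joshi/ATS4RamificationTateDivisor.lean` (slot T-26) types Lemma 4.1.4 over GENUINE number fields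
(`TowerDatum L_tpd L L′`, `UnramifiedOutside`, `relRamIdx` = Mathlib's relative ramification index). This file instantiates the
former at the latter:

* `TowerDatum.ramificationDatum` — the ramification signature of a genuine tower (places = `HeightOneSpectrum (𝓞 L_tpd)`,
  «divides» = residue characteristic divides, «unramified over v» = `e(w|v) = 1` for every place `w` over `v`; the tower field
  is multiplicativity of `e`, tree `Literature.NumberTheory.NumberFields.ramificationIdx_rel_eq_one_of_eq_one_of_eq_one`);
* `lem414a_of_lem414_1`, `lem414b_of_lem414_2` — T-26's `Lem414_1` / `Lem414_2` imply T-30's input readings `Lem414a` / `Lem414b`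
  (the residue characteristic is constant along `w | v`, tree `residueChar_finBelow`);
* `lem651_of_lem414_tower` and the unfolded **`relRamIdx_eq_one_of_lem414`**: for genuine `L_tpd ⊆ L ⊆ L′` satisfying Joshi's
  Lemma 4.1.4 (a HYPOTHESIS here; a THEOREM on the tree's Legendre theta tower by `lem414_of_divisionTower`,
  `Joshi/ATS4RamificationLegendreTower.lean`), every finite place `u` of `L′` whose restriction `v` to `L_tpd` has residue
  characteristic `∤ 2·3·5·ℓ` and lies outside `Supp(𝔮_{L_tpd})` has `e(u|v) = 1` — Lem 6.5.1 verbatim.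

Proof-only apart from the one dictionary `def` (`ramificationDatum`); standard axioms; no `Cor312*`/`Thm311*` import (E-PLAN R14).
[claim: Joshi2024ATS4, status: disputed] for the transcribed items; the mathematics used is classical (Neukirch II (7.8)).
-/

noncomputable section

namespace Summit.ABC.IUTFork.Joshi.ATS4

open NumberField IsDedekindDomain

namespace TowerDatum

variable {Ltpd L L' : Type} [Field Ltpd] [NumberField Ltpd] [Field L] [NumberField L] [Field L'] [NumberField L']
  [Algebra Ltpd L] [Algebra L L'] [Algebra Ltpd L'] [IsScalarTower Ltpd L L'] (𝓣 : TowerDatum Ltpd L L')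

/-- `e_{w|v}` of [J-IV] §4.2 (T-26's `relRamIdx`, Mathlib's `Ideal.ramificationIdx'`) is Mathlib's `Ideal.ramificationIdx` of `w`
over `𝓞` of the base (as in `Joshi/ATS4RamificationLegendreTower.lean`). [folklore] -/
private theorem relRamIdx_eq' {A B : Type} [Field A] [Field B] [NumberField B] [Algebra A B]
    (u : HeightOneSpectrum (𝓞 B)) : relRamIdx A B u = u.asIdeal.ramificationIdx (𝓞 A) := by
  haveI : u.asIdeal.IsPrime := u.isPrime
  rw [relRamIdx, Ideal.ramificationIdx'_eq_ramificationIdx (p := (Literature.IUT.LogVolume.finBelow A B u).asIdeal)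
    (q := u.asIdeal) (Literature.IUT.LogVolume.finBelow A B u).ne_bot]

omit [NumberField Ltpd] in
/-- **Unramified over unramified is unramified** in the tower `L_tpd ⊆ L ⊆ L′`: `e(u|w) = 1` and `e(w|v) = 1` for `w = u ∩ 𝓞_L`
give `e(u|v) = 1` (multiplicativity of ramification indices, Neukirch II (7.8); tree
`ramificationIdx_rel_eq_one_of_eq_one_of_eq_one`). [folklore] -/
theorem relRamIdx_tower_eq_one (u : HeightOneSpectrum (𝓞 L')) (htop : relRamIdx L L' u = 1)
    (hbot : relRamIdx Ltpd L (Literature.IUT.LogVolume.finBelow L L' u) = 1) : relRamIdx Ltpd L' u = 1 := by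
  rw [relRamIdx_eq'] at htop hbot ⊢
  exact Literature.NumberTheory.NumberFields.ramificationIdx_rel_eq_one_of_eq_one_of_eq_one Ltpd L L' u.asIdeal htop hbot

/-- **The ramification signature of a genuine tower** `L_tpd ⊆ L ⊆ L′` with T-26's datum `𝓣` (the prime `ℓ`, the support
`Supp(𝔮_{L_tpd})`): places `V = V^non_{L_tpd}`; «v divides 2·3·5·ℓ» / «v divides 2·ℓ» = the residue characteristic of `v` divides
`30ℓ` / `2ℓ`; «v ∈ Supp(𝔮_{L_tpd})» = `v ∈ 𝓣.suppq`; «M′/M unramified over v» = `e = 1` at every finite place of the top field over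
`v`, for the three steps `L/L_tpd`, `L′/L`, `L′/L_tpd`; the tower field is `relRamIdx_tower_eq_one`. DICTIONARY `def` (OUR READING of
[J-IV] §4.1.2 (8)–(9), Lemma 4.1.4 p.38 l.32–40, Lem 6.5.1 p.60 l.46–50 on genuine fields). [claim: Joshi2024ATS4, status: disputed] -/
def ramificationDatum : RamificationDatum where
  V := HeightOneSpectrum (𝓞 Ltpd)
  DividesThirtyEll v := Literature.IUT.LogVolume.residueChar Ltpd v ∣ 2 * 3 * 5 * 𝓣.ell
  DividesTwoEll v := Literature.IUT.LogVolume.residueChar Ltpd v ∣ 2 * 𝓣.ell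
  dividesTwoEll_imp v h := h.trans ⟨15, by ring⟩
  InSuppTate v := v ∈ 𝓣.suppq
  UnramL v := ∀ w : HeightOneSpectrum (𝓞 L), Literature.IUT.LogVolume.finBelow Ltpd L w = v → relRamIdx Ltpd L w = 1
  UnramLpL v := ∀ u : HeightOneSpectrum (𝓞 L'),
    Literature.IUT.LogVolume.finBelow Ltpd L (Literature.IUT.LogVolume.finBelow L L' u) = v → relRamIdx L L' u = 1
  UnramLp v := ∀ u : HeightOneSpectrum (𝓞 L'), Literature.IUT.LogVolume.finBelow Ltpd L' u = v → relRamIdx Ltpd L' u = 1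
  unram_tower v hL hLpL u hu := by
    have hw : Literature.IUT.LogVolume.finBelow Ltpd L (Literature.IUT.LogVolume.finBelow L L' u) = v := by
      rw [Literature.IUT.LogVolume.finBelow_finBelow Ltpd L L' u]; exact hu
    exact relRamIdx_tower_eq_one u (hLpL u hw) (hL _ hw)

/-- **T-26's Lemma 4.1.4 (1) ⟹ T-30's input reading `Lem414a`** («L/L_tpd is unramified outside {v | 2·3·5·ℓ} ∪ Supp(𝔮_{L_tpd})»,
[J-IV] p.38 l.32–33). [claim: Joshi2024ATS4, status: disputed] -/
theorem lem414a_of_lem414_1 (h : 𝓣.Lem414_1) : 𝓣.ramificationDatum.Lem414a := by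
  intro v h30 hq w hw
  refine h.1 w ?_
  rw [hw]
  simp only [Set.mem_union, Set.mem_setOf_eq, Finset.mem_coe, not_or]
  exact ⟨h30, hq⟩

/-- **T-26's Lemma 4.1.4 (2) ⟹ T-30's input reading `Lem414b`** («L′/L is unramified outside {v | 2·ℓ} ∪ Supp(𝔮_{L_tpd})», read at
the places of `L` over those of `L_tpd`, [J-IV] p.38 l.36–37): the residue characteristic of `w` is that of `v = w|_{L_tpd}` (tree
`residueChar_finBelow`). [claim: Joshi2024ATS4, status: disputed] -/
theorem lem414b_of_lem414_2 (h : 𝓣.Lem414_2) : 𝓣.ramificationDatum.Lem414b := by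
  intro v h2 hq u hu
  refine h.1 u ?_
  simp only [Set.mem_setOf_eq, not_or]
  refine ⟨?_, ?_⟩
  · rw [← Literature.IUT.LogVolume.residueChar_finBelow (F := Ltpd) (Literature.IUT.LogVolume.finBelow L L' u)]
    rw [show Literature.IUT.LogVolume.finBelow Ltpd L (Literature.IUT.LogVolume.finBelow L L' u) = v from hu]
    exact h2
  · rw [show Literature.IUT.LogVolume.finBelow Ltpd L (Literature.IUT.LogVolume.finBelow L L' u) = v from hu]
    exact hq

/-- **Lem 6.5.1 for the genuine tower from Lemma 4.1.4** (T-30's `lem651_of_lem414` at the genuine signature).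
[claim: Joshi2024ATS4, status: disputed] -/
theorem lem651_of_lem414_tower (h : 𝓣.Lem414) : 𝓣.ramificationDatum.Lem651 :=
  𝓣.ramificationDatum.lem651_of_lem414 (𝓣.lem414a_of_lem414_1 h.1) (𝓣.lem414b_of_lem414_2 h.2)

/-- **[J-IV] Lem 6.5.1, verbatim on genuine number fields** (p.60 l.46–50): for `L_tpd ⊆ L ⊆ L′` satisfying Lemma 4.1.4 (hypothesis
`𝓣.Lem414` — a theorem on the tree's Legendre theta tower, `lem414_of_divisionTower`), if a finite place `u` of `L′` restricts to a
place `v` of `L_tpd` with residue characteristic `∤ 2·3·5·ℓ` and `v ∉ Supp(𝔮_{L_tpd})`, then `e(u|v) = 1`, i.e. `L′/L_tpd` is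
unramified over `v`. PROVED (from the hypothesis). [claim: Joshi2024ATS4, status: disputed] -/
theorem relRamIdx_eq_one_of_lem414 (h : 𝓣.Lem414) (u : HeightOneSpectrum (𝓞 L'))
    (h30 : ¬ Literature.IUT.LogVolume.residueChar Ltpd (Literature.IUT.LogVolume.finBelow Ltpd L' u) ∣ 2 * 3 * 5 * 𝓣.ell)
    (hq : Literature.IUT.LogVolume.finBelow Ltpd L' u ∉ 𝓣.suppq) : relRamIdx Ltpd L' u = 1 :=
  𝓣.lem651_of_lem414_tower h (Literature.IUT.LogVolume.finBelow Ltpd L' u) h30 hq u rfl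

/-- The same in T-26's vocabulary: under Lemma 4.1.4, `L′/L_tpd` is `UnramifiedOutside` the printed exceptional set
`{v : p_v ∣ 2·3·5·ℓ} ∪ Supp(𝔮_{L_tpd})`. [claim: Joshi2024ATS4, status: disputed] -/
theorem unramifiedOutside_tower_of_lem414 (h : 𝓣.Lem414) :
    UnramifiedOutside Ltpd L' ({v | Literature.IUT.LogVolume.residueChar Ltpd v ∣ 2 * 3 * 5 * 𝓣.ell} ∪ ↑𝓣.suppq) := by
  intro u hu
  simp only [Set.mem_union, Set.mem_setOf_eq, Finset.mem_coe, not_or] at hu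
  exact 𝓣.relRamIdx_eq_one_of_lem414 h u hu.1 hu.2

end TowerDatum

end Summit.ABC.IUTFork.Joshi.ATS4

end
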